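import Mathlib
import HarnessLib
import Literature.Computability.AlgebraicComplexity.PatternExpressions
import Summits.ValiantsHypothesis.ValiantsHypothesis.Theorems.MonotoneRestorationOrbitCompressionQPSymmetricOfRowGadget

/-!
# Route MonotoneRestoration — aside `OrbitCompressionQP` (stmt-ValiantsHypothesis-18332), line
# `expression_compression`: the MASTER ONE-ROW THEOREM — symmetric `VQP` functions, row by row, of an
# equivariant ENTRY gadget

Unifies `Theorems/…OneRowStratum.lean` (entry gadget `u(i, j) = x_ij`) and `…SymmetricOfRowGadget.lean`: let
`U_n` be a `(1,1)`-label pattern expression of quasi-polynomial length whose value at `(ρ, γ)` is a polynomial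
`u_n(ρ 0, γ 0)` of the pinned row AND column (e.g. `x_ij`, `x_ij · c_j` with `c_j` the column sum, `x_ij^2 + r_i`,
…), and let `h_n ∈ ℂ[y_0, …, y_{n-1}]^{S_n}` be a `VQP` family of symmetric polynomials.  Then
`f_n = Σ_i h_n(u_n(i, 0), …, u_n(i, n-1))` is narrow of quasi-polynomial length:

* `exists_entryGadgetPowerSum` — `Σ_j u_n(ρ 0, j)^b` as a `(1,1)`-expression with the row label OPEN;
* ★★ `narrowQP_oneRow_entryGadget` — the theorem (Newton substituends with open labels
  `FormulaSubstitution.exists_esymm_subst` → symmetric cores `VQP` by Bläser–Jindal (`isVQPFamily_symmetricCore`)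
  → `VQP` substitution principle → `sumRow` → normalisation).

Helper file (`--supports stmt-ValiantsHypothesis-18332`); def-free; nothing here is a named fact; no registered
stub is closed; VP ≠ VNP is not moved.
-/

noncomputable section

open MvPolynomial

-- `Summit.ValiantsHypothesis.ValiantsHypothesis.…` is the tree's single-conjunct layout (Sub = Summit).
set_option linter.dupNamespace false

namespace Summit.ValiantsHypothesis.ValiantsHypothesis.Theorems

namespace FormulaSubstitution

open Literature.Computability.AlgebraicComplexity

section SingleLevel

variable {F : Type} [CommSemiring F]

/-- **Power sums of an entry gadget along the pinned row**: if the value of `U` at `(ρ, γ)` is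
`u (ρ 0) (γ 0)`, then `sumCol 0 (U^b)` has value `Σ_j (u (ρ 0) j)^b` (row label open, column label idle)
and length `b (|U| + 1) + 2`. [folklore] -/
theorem exists_entryGadgetPowerSum {n : ℕ} (U : PatternExpr F 1 1)
    (u : Fin n → Fin n → MvPolynomial (Fin n × Fin n) F)
    (hU : ∀ (ρ γ : Fin 1 → Fin n), U.value n ρ γ = u (ρ 0) (γ 0)) (b : ℕ) :
    ∃ q : PatternExpr F 1 1, q.length = b * (U.length + 1) + 2 ∧
      ∀ (ρ γ : Fin 1 → Fin n), q.value n ρ γ = ∑ j : Fin n, (u (ρ 0) j) ^ b := by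
  obtain ⟨q, hl, hv⟩ := exists_pow U b
  refine ⟨PatternExpr.sumCol 0 q, by simp [PatternExpr.length, hl], fun ρ γ => ?_⟩
  simp only [PatternExpr.value_sumCol, hv, hU, Function.update_self]

end SingleLevel

section Strata

/-- ★★ **Master one-row theorem.**  For a `VQP` family of symmetric polynomials `h_n ∈ ℂ[y_0, …, y_{n-1}]`
and `(1,1)`-label entry gadgets `U_n` of quasi-polynomial length with values `u_n(ρ 0, γ 0)`, the family
`f_n = Σ_i h_n(u_n(i, 0), …, u_n(i, n-1))` satisfies the conclusion of `stub_narrowExpressionCompression`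
(`(1,1)` labels). [cite: BlaserJindal2019, Thm. 4] -/
theorem narrowQP_oneRow_entryGadget (h : (n : ℕ) → MvPolynomial (Fin n) ℂ)
    (hsymm : ∀ n, (h n).IsSymmetric) (hh : IsVQPFamily h)
    (U : ℕ → PatternExpr ℂ 1 1) (u : (n : ℕ) → Fin n → Fin n → MvPolynomial (Fin n × Fin n) ℂ)
    (hU : ∃ c : ℕ, ∀ n : ℕ, 1 ≤ n → (U n).length ≤ 2 ^ ((Nat.log 2 n + c) ^ c) ∧
      ∀ (ρ γ : Fin 1 → Fin n), (U n).value n ρ γ = u n (ρ 0) (γ 0)) :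
    ∃ c : ℕ, ∀ n : ℕ, 1 ≤ n → ∃ (k l : ℕ) (e : PatternExpr ℂ k l),
      n ^ (k + l) ≤ 2 ^ ((Nat.log 2 n + c) ^ c) ∧ e.length ≤ 2 ^ ((Nat.log 2 n + c) ^ c) ∧
      e.close n = ∑ i : Fin n, aeval (u n i) (h n) := by
  classical
  choose P hP using fun n => exists_symmetricCore (h n) (hsymm n)
  have hPq : IsVQPFamily P := isVQPFamily_symmetricCore h P hP hh
  obtain ⟨a, ha⟩ := hU
  -- Newton substituends `e_j(u_n(ρ 0, ·))` with the row label open, for `n ≥ 1`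
  have hsub : ∀ n : ℕ, ∃ E : ℕ → PatternExpr ℂ 1 1, 1 ≤ n → ∀ j : ℕ, j ≤ n →
      (E j).length ≤ (2 * (n + 1) + 2) ^ (Nat.log 2 n + 1) *
        ((n * ((U n).length + 1) + 2) + 2 + (n + 1) + 1) ∧
      ∀ (ρ γ : Fin 1 → Fin n), (E j).value n ρ γ = aeval (u n (ρ 0)) (esymm (Fin n) ℂ j) := by
    intro n
    by_cases hn : 1 ≤ n
    swap
    · exact ⟨fun _ => PatternExpr.const 0, fun h1 => absurd h1 hn⟩
    choose pw hpwl hpwv using fun b : ℕ => exists_entryGadgetPowerSum (U n) (u n) (ha n hn).2 b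
    obtain ⟨E, hE⟩ := exists_esymm_subst (ι := Fin n) (k := 1) (l := 1) n n (n * ((U n).length + 1) + 2)
      (fun j ρ _ => u n (ρ 0) j) pw fun b hb => ⟨by rw [hpwl]; nlinarith, fun ρ γ => hpwv b ρ γ⟩
    exact ⟨E, fun _ j hj => hE j hj⟩
  choose E hE using hsub
  have hθ : ∃ c : ℕ, ∀ n : ℕ, 1 ≤ n → ∀ j : Fin n,
      (E n (j.val + 1)).length ≤ 2 ^ ((Nat.log 2 n + c) ^ c) := by
    obtain ⟨c, hc⟩ := gadget_esymm_length_qp a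
    exact ⟨c, fun n hn j => ((hE n hn (j.val + 1) (by omega)).1).trans (hc n _ hn (ha n hn).1)⟩
  obtain ⟨c₁, hc₁⟩ := exists_narrow_subst_of_isVQPFamily (m := fun n => n) P hPq
    (k := fun _ => 1) (l := fun _ => 1) (fun n j => E n (j.val + 1)) hθ
  obtain ⟨c₂, hc₂⟩ := NarrowClosure.qp_combine c₁ 0
  refine ⟨max c₂ 3, fun n hn => ?_⟩
  obtain ⟨e, hl, hv⟩ := hc₁ n hn
  have hval : ∀ (ρ γ : Fin 1 → Fin n), (PatternExpr.sumRow 0 e).value n ρ γ =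
      ∑ i : Fin n, aeval (u n i) (h n) := by
    intro ρ γ
    simp only [PatternExpr.value_sumRow, hv]
    refine Finset.sum_congr rfl fun i _ => ?_
    have hfun : (fun j : Fin n => (E n (j.val + 1)).value n (Function.update ρ 0 i) γ) =
        fun j : Fin n => aeval (u n i) (esymm (Fin n) ℂ (j.val + 1)) := by
      funext j
      rw [(hE n hn (j.val + 1) (by omega)).2, Function.update_self]
    rw [hfun, ← hP n, ← AlgHom.comp_apply, comp_aeval]
  obtain ⟨e', hl', hc'⟩ := exists_close_eq_of_value_const hn (PatternExpr.sumRow 0 e) _ hval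
  refine ⟨1, 1, e', ?_, ?_, hc'⟩
  · calc n ^ (1 + 1) ≤ n ^ 2 + 2 := by norm_num
      _ ≤ 2 ^ ((Nat.log 2 n + 3) ^ 3) := CompressionFloors.pbounded_le_qp n 2
      _ ≤ 2 ^ ((Nat.log 2 n + max c₂ 3) ^ max c₂ 3) :=
          Nat.pow_le_pow_right (by norm_num) (CompressionFloors.polylog_mono (le_max_right _ _))
  · have h2 := hc₂ (Nat.log 2 n) e.length 0 hl (by simp)
    calc e'.length = e.length + 3 := by rw [hl']; simp [PatternExpr.length]
      _ ≤ (e.length + 2) * (0 + 2) := by omega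
      _ ≤ 2 ^ ((Nat.log 2 n + c₂) ^ c₂) := h2
      _ ≤ 2 ^ ((Nat.log 2 n + max c₂ 3) ^ max c₂ 3) :=
          Nat.pow_le_pow_right (by norm_num) (CompressionFloors.polylog_mono (le_max_left _ _))

/-- **Example entry gadget `x_ij · c_j`** (`c_j` the column sum): for every `VQP` family of symmetric `h_n`,
`Σ_i h_n((x_{i,j} c_j)_j)` is narrow of quasi-polynomial length. [cite: BlaserJindal2019, Thm. 4] -/
theorem narrowQP_oneRow_columnWeighted (h : (n : ℕ) → MvPolynomial (Fin n) ℂ)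
    (hsymm : ∀ n, (h n).IsSymmetric) (hh : IsVQPFamily h) :
    ∃ c : ℕ, ∀ n : ℕ, 1 ≤ n → ∃ (k l : ℕ) (e : PatternExpr ℂ k l),
      n ^ (k + l) ≤ 2 ^ ((Nat.log 2 n + c) ^ c) ∧ e.length ≤ 2 ^ ((Nat.log 2 n + c) ^ c) ∧
      e.close n = ∑ i : Fin n, aeval (fun j : Fin n =>
        (X (i, j) : MvPolynomial (Fin n × Fin n) ℂ) * ∑ i' : Fin n, X (i', j)) (h n) := by
  refine narrowQP_oneRow_entryGadget h hsymm hh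
    (fun _ => PatternExpr.mul (PatternExpr.edge 0 0) (PatternExpr.sumRow 0 (PatternExpr.edge 0 0)))
    (fun n i j => (X (i, j) : MvPolynomial (Fin n × Fin n) ℂ) * ∑ i' : Fin n, X (i', j))
    ⟨2, fun n _ => ⟨?_, fun ρ γ => by simp⟩⟩
  have h4 : 2 ^ 2 ≤ (Nat.log 2 n + 2) ^ 2 := Nat.pow_le_pow_left (by omega) 2
  calc (PatternExpr.mul (PatternExpr.edge 0 0) (PatternExpr.sumRow 0 (PatternExpr.edge 0 0)) :
          PatternExpr ℂ 1 1).length = 4 := by simp [PatternExpr.length]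
    _ ≤ 2 ^ (2 ^ 2) := by norm_num
    _ ≤ 2 ^ ((Nat.log 2 n + 2) ^ 2) := Nat.pow_le_pow_right (by norm_num) h4

end Strata

end FormulaSubstitution

end Summit.ValiantsHypothesis.ValiantsHypothesis.Theorems

end
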